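import Mathlib.Tactic
import HarnessLib
import HarnessLib.Audit.Tags
import Summits.CriticalPhenomena.PercolationContinuityZ3.Theorems.PercNearOneGluingNoHeavyLowerTailSahiAntichainSplitSeven

/-!
# Antichains, meets plus joins: a `3 + 2` split with a sunflower three-side creates three new labels

Support file (seat `prim-masterthm-p1`, gen 36; `--supports stmt-CriticalPhenomena-4575`).  No `sorry`, no new definitions, standard
axioms.  Memo `run/shared/lean/prim/prim-masterthm/FROM-prim-masterthm-p1-g36-DUALITY-PROJECTION-SUNFLOWER.md` §7.

SETTING (files `…SahiAntichainSplit*`): the sunflower step (`…SplitSunflower`) gives `newLabels ≥ 2` whenever the members containing `r`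
form a sunflower with three petals.  Here exactly three members contain `r` (a sunflower with core `K`) and exactly two avoid it.

NEW HERE ([this work], gen 36): `three_le_newLabels_of_sunflower_three_two` — then `newLabels ≥ 3`.  [For each member `b` avoiding
`r`: if all its cross meets are the old meet `b ∩ b'` then `b` meets no petal and its three cross joins are new and pairwise distinct;
otherwise `b` has a new cross meet; and, by the tameness analysis of the sunflower step, over each `b` there are two distinct new joins
or two distinct new meets (a tame member contains two full petals, so its three cross meets are pairwise distinct); finally every
member has at least one new join over it.  Adding up gives three.]  By complement duality `three_le_newLabels_of_two_cosunflower_three`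
(`#above = 2`, `below` a three-member co-sunflower).  Together with `…SplitTwoThree` this completes: **at a `2 + 3` or `3 + 2` point
whose three-side is a (co)sunflower, `newLabels ≥ 3`** — the ingredient for «five members ⟹ nine labels» and V5 with eight members.
HONEST FRAMING: V5 in general remains OPEN. [this work]
-/

namespace Summit.CriticalPhenomena.PercolationContinuityZ3.Theorems.SahiColouredDaykin

open Finset

variable {α : Type*} [DecidableEq α]

/-- **`3 + 2`, sunflower above.** [this work] -/
theorem three_le_newLabels_of_sunflower_three_two {P : Finset (Finset α)} {r : α} {K : Finset α}
    (hanti : IsAntichain (· ⊆ ·) (P : Set (Finset α))) (h3 : #(above P r) = 3) (h2 : #(below P r) = 2)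
    (hK : ∀ a ∈ above P r, ∀ a' ∈ above P r, a ≠ a' → a ∩ a' = K) : 3 ≤ newLabels P r := by
  have h1 : 1 < #(above P r) := by omega
  obtain ⟨b₁, b₂, hbb, hBeq⟩ := card_eq_two.1 h2
  have hb₁ : b₁ ∈ below P r := by rw [hBeq]; simp
  have hb₂ : b₂ ∈ below P r := by rw [hBeq]; simp
  obtain ⟨a₁, a₂, a₃, h12, h13, h23, hAeq⟩ := card_eq_three.1 h3
  have ha₁ : a₁ ∈ above P r := by rw [hAeq]; simp
  have ha₂ : a₂ ∈ above P r := by rw [hAeq]; simp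
  have ha₃ : a₃ ∈ above P r := by rw [hAeq]; simp
  have hM : meets (below P r) = {b₁ ∩ b₂} := by rw [hBeq, meets_pair hbb]
  have nM : ∀ {x y : Finset α}, x ∈ above P r → y ∈ below P r → x ∩ y ≠ b₁ ∩ b₂ → x ∩ y ∈ newMeets P r := by
    intro x y hx hy hne; rw [inter_mem_newMeets_iff hx hy, hM, mem_singleton]; exact hne
  have nJ : ∀ {x y : Finset α}, x ∈ above P r → y ∈ below P r → x ∪ y ∉ joins (above P r) → x ∪ y ∈ newJoins P r := by
    intro x y hx hy hne; rw [union_mem_newJoins_iff hx hy]; exact hne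
  -- counting
  have cnt21 : ∀ {Z₁ Z₂ W : Finset α}, Z₁ ∈ newMeets P r → Z₂ ∈ newMeets P r → Z₁ ≠ Z₂ → W ∈ newJoins P r → 3 ≤ newLabels P r := by
    intro Z₁ Z₂ W h1' h2' h12' hW
    have := card_add_card_le_newLabels (S := {Z₁, Z₂}) (T := {W})
      (by intro Z hZ; rcases mem_insert.1 hZ with rfl | hZ; exact h1'; rw [mem_singleton.1 hZ]; exact h2')
      (by intro V hV; rw [mem_singleton.1 hV]; exact hW)
    rw [card_pair h12', card_singleton] at this; omega
  have cnt12 : ∀ {Z W₁ W₂ : Finset α}, Z ∈ newMeets P r → W₁ ∈ newJoins P r → W₂ ∈ newJoins P r → W₁ ≠ W₂ → 3 ≤ newLabels P r := by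
    intro Z W₁ W₂ hZ h1' h2' h12'
    have := card_add_card_le_newLabels (S := {Z}) (T := {W₁, W₂})
      (by intro V hV; rw [mem_singleton.1 hV]; exact hZ)
      (by intro V hV; rcases mem_insert.1 hV with rfl | hV; exact h1'; rw [mem_singleton.1 hV]; exact h2')
    rw [card_pair h12', card_singleton] at this; omega
  have cnt03 : ∀ {W₁ W₂ W₃ : Finset α}, W₁ ∈ newJoins P r → W₂ ∈ newJoins P r → W₃ ∈ newJoins P r →
      W₁ ≠ W₂ → W₁ ≠ W₃ → W₂ ≠ W₃ → 3 ≤ newLabels P r := by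
    intro W₁ W₂ W₃ h1' h2' h3' h12' h13' h23'
    have := card_add_card_le_newLabels (S := ∅) (T := {W₁, W₂, W₃}) (empty_subset _)
      (by
        intro W hW
        rcases mem_insert.1 hW with rfl | hW; exact h1'
        rcases mem_insert.1 hW with rfl | hW; exact h2'
        rw [mem_singleton.1 hW]; exact h3')
    rw [card_eq_three.2 ⟨_, _, _, h12', h13', h23', rfl⟩, card_empty] at this; omega
  -- every member contains the core; petal points
  have hKa : ∀ {a : Finset α}, a ∈ above P r → K ⊆ a := fun ha => core_subset_of_sunflower h1 hK ha
  -- (I) a member below all of whose cross meets are old meets no petal; then its three cross joins are new and distinct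
  have allOld : ∀ {b : Finset α}, b ∈ below P r → a₁ ∩ b = b₁ ∩ b₂ → a₂ ∩ b = b₁ ∩ b₂ → a₃ ∩ b = b₁ ∩ b₂ →
      3 ≤ newLabels P r := by
    intro b hb e1 e2 e3
    -- petal points avoid b
    have avoid : ∀ {a a' : Finset α}, a ∈ above P r → a' ∈ above P r → a ≠ a' → a ∩ b = b₁ ∩ b₂ → a' ∩ b = b₁ ∩ b₂ →
        ∀ {t : α}, t ∈ a → t ∉ K → t ∉ b := by
      intro a a' ha ha' hne hm hm' t hta htK htb
      have : t ∈ a' ∩ b := by rw [hm', ← hm]; exact mem_inter.2 ⟨hta, htb⟩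
      exact htK (mem_core_of_mem_mem hK ha ha' hne hta (mem_inter.1 this).1)
    -- the cross joins over b are new: an old join e ∪ e' contains two petals, but a ∪ b contains only the petal of a
    have newb : ∀ {a : Finset α}, a ∈ above P r → a ∩ b = b₁ ∩ b₂ →
        (∀ {a' : Finset α}, a' ∈ above P r → a' ≠ a → ∀ {t : α}, t ∈ a' → t ∉ K → t ∉ b) → a ∪ b ∈ newJoins P r := by
      intro a ha hm hav
      apply nJ ha hb
      intro hold
      obtain ⟨e, he, hea, hsw, _⟩ := exists_swallowed_of_union_mem_joins hanti h1 hK ha hold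
      obtain ⟨t, hte, htK⟩ := exists_mem_not_mem_core hanti h1 hK he
      exact hav he hea hte htK (hsw t hte htK)
    have hav1 : ∀ {a' : Finset α}, a' ∈ above P r → a' ≠ a₁ → ∀ {t : α}, t ∈ a' → t ∉ K → t ∉ b := by
      intro a' ha' hne t ht htK
      by_cases h2' : a' = a₂
      · subst h2'; exact avoid ha' ha₁ hne e2 e1 ht htK
      · by_cases h3' : a' = a₃
        · subst h3'; exact avoid ha' ha₁ hne e3 e1 ht htK
        · have : a' ∈ ({a₁, a₂, a₃} : Finset (Finset α)) := hAeq ▸ ha'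
          simp only [mem_insert, mem_singleton] at this
          rcases this with h | h | h
          · exact absurd h hne
          · exact absurd h h2'
          · exact absurd h h3'
    have hav2 : ∀ {a' : Finset α}, a' ∈ above P r → a' ≠ a₂ → ∀ {t : α}, t ∈ a' → t ∉ K → t ∉ b := by
      intro a' ha' hne t ht htK
      by_cases h1' : a' = a₁
      · subst h1'; exact avoid ha' ha₂ hne e1 e2 ht htK
      · by_cases h3' : a' = a₃
        · subst h3'; exact avoid ha' ha₂ hne e3 e2 ht htK
        · have : a' ∈ ({a₁, a₂, a₃} : Finset (Finset α)) := hAeq ▸ ha'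
          simp only [mem_insert, mem_singleton] at this
          rcases this with h | h | h
          · exact absurd h h1'
          · exact absurd h hne
          · exact absurd h h3'
    have hav3 : ∀ {a' : Finset α}, a' ∈ above P r → a' ≠ a₃ → ∀ {t : α}, t ∈ a' → t ∉ K → t ∉ b := by
      intro a' ha' hne t ht htK
      by_cases h1' : a' = a₁
      · subst h1'; exact avoid ha' ha₃ hne e1 e3 ht htK
      · by_cases h2' : a' = a₂
        · subst h2'; exact avoid ha' ha₃ hne e2 e3 ht htK
        · have : a' ∈ ({a₁, a₂, a₃} : Finset (Finset α)) := hAeq ▸ ha'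
          simp only [mem_insert, mem_singleton] at this
          rcases this with h | h | h
          · exact absurd h h1'
          · exact absurd h h2'
          · exact absurd h hne
    have w1 := newb ha₁ e1 hav1
    have w2 := newb ha₂ e2 hav2
    have w3 := newb ha₃ e3 hav3
    -- pairwise distinct: a petal point of a_i is in a_i ∪ b but not in a_j ∪ b
    have dis : ∀ {a a' : Finset α}, a ∈ above P r → a' ∈ above P r → a ≠ a' →
        (∀ {t : α}, t ∈ a → t ∉ K → t ∉ b) → a ∪ b ≠ a' ∪ b := by
      intro a a' ha ha' hne hav
      obtain ⟨t, hta, htK⟩ := exists_mem_not_mem_core hanti h1 hK ha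
      exact union_ne_union_of_not_swallowed hK ha ha' hne hta htK (hav hta htK)
    exact cnt03 w1 w2 w3 (dis ha₁ ha₂ h12 (fun ht htK => hav2 ha₁ h12 ht htK))
      (dis ha₁ ha₃ h13 (fun ht htK => hav3 ha₁ h13 ht htK)) (dis ha₂ ha₃ h23 (fun ht htK => hav3 ha₂ h23 ht htK))
  -- (II) over each member below: two distinct new joins, or two distinct new meets
  have perB : ∀ {b : Finset α}, b ∈ below P r →
      (∃ W₁ ∈ newJoins P r, ∃ W₂ ∈ newJoins P r, W₁ ≠ W₂) ∨ (∃ Z₁ ∈ newMeets P r, ∃ Z₂ ∈ newMeets P r, Z₁ ≠ Z₂) := by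
    intro b hb
    -- three pairwise distinct cross meets over b give two new ones
    have threeMeets : ∀ {x y z : Finset α}, x ∈ above P r → y ∈ above P r → z ∈ above P r →
        x ∩ b ≠ y ∩ b → x ∩ b ≠ z ∩ b → y ∩ b ≠ z ∩ b →
        (∃ Z₁ ∈ newMeets P r, ∃ Z₂ ∈ newMeets P r, Z₁ ≠ Z₂) := by
      intro x y z hx hy hz hxy hxz hyz
      by_cases ex : x ∩ b = b₁ ∩ b₂
      · exact ⟨_, nM hy hb (fun h => hxy (ex.trans h.symm)), _, nM hz hb (fun h => hxz (ex.trans h.symm)), hyz⟩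
      · by_cases ey : y ∩ b = b₁ ∩ b₂
        · exact ⟨_, nM hx hb ex, _, nM hz hb (fun h => hyz (ey.trans h.symm)), hxz⟩
        · exact ⟨_, nM hx hb ex, _, nM hy hb ey, hxy⟩
    -- two full petals inside b make the three cross meets pairwise distinct
    have twoPetals : ∀ {a e d : Finset α}, a ∈ above P r → e ∈ above P r → d ∈ above P r → a ≠ e → d ≠ a → d ≠ e →
        (∀ x ∈ a, x ∉ K → x ∈ b) → (∀ x ∈ e, x ∉ K → x ∈ b) →
        (∃ Z₁ ∈ newMeets P r, ∃ Z₂ ∈ newMeets P r, Z₁ ≠ Z₂) := by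
      intro a e d ha he hd hae hda hde hsa hse
      obtain ⟨t, hta, htK⟩ := exists_mem_not_mem_core hanti h1 hK ha
      obtain ⟨s, hse', hsK⟩ := exists_mem_not_mem_core hanti h1 hK he
      have htb : t ∈ b := hsa t hta htK
      have hsb : s ∈ b := hse s hse' hsK
      refine threeMeets ha he hd ?_ ?_ ?_
      · intro h; have : t ∈ e ∩ b := h ▸ mem_inter.2 ⟨hta, htb⟩
        exact htK (mem_core_of_mem_mem hK ha he hae hta (mem_inter.1 this).1)
      · intro h; have : t ∈ d ∩ b := h ▸ mem_inter.2 ⟨hta, htb⟩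
        exact htK (mem_core_of_mem_mem hK ha hd hda.symm hta (mem_inter.1 this).1)
      · intro h; have : s ∈ d ∩ b := h ▸ mem_inter.2 ⟨hse', hsb⟩
        exact hsK (mem_core_of_mem_mem hK he hd hde.symm hse' (mem_inter.1 this).1)
    by_cases hold : ∃ a ∈ above P r, a ∪ b ∈ joins (above P r)
    · obtain ⟨a, ha, hab⟩ := hold
      obtain ⟨e, he, hea, hsw, hbae⟩ := exists_swallowed_of_union_mem_joins hanti h1 hK ha hab
      obtain ⟨d, hd, hda, hde⟩ := exists_third (by omega : 3 ≤ #(above P r)) a e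
      have hdnew : d ∪ b ∈ newJoins P r :=
        nJ hd hb (union_not_mem_joins_of_third hanti h1 hK ha he hd hb hea.symm hda hde hsw hbae)
      obtain ⟨x, hxd, hxK⟩ := exists_mem_not_mem_core hanti h1 hK hd
      have hxb : x ∉ b := by
        intro hxb
        rcases mem_union.1 (hbae hxb) with h | h
        · exact hxK (mem_core_of_mem_mem hK hd ha hda hxd h)
        · exact hxK (mem_core_of_mem_mem hK hd he hde hxd h)
      by_cases heold : e ∪ b ∈ joins (above P r)
      · -- then a's petal is also inside b: two full petals
        obtain ⟨e'', he'', hne'', hsw'', _⟩ := exists_swallowed_of_union_mem_joins hanti h1 hK he heold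
        obtain ⟨y, hye'', hyK⟩ := exists_mem_not_mem_core hanti h1 hK he''
        have hyb : y ∈ b := hsw'' y hye'' hyK
        have he''a : e'' = a := by
          rcases mem_union.1 (hbae hyb) with h | h
          · by_contra hne; exact hyK (mem_core_of_mem_mem hK he'' ha hne hye'' h)
          · exact absurd (mem_core_of_mem_mem hK he'' he hne'' hye'' h) hyK
        subst he''a
        exact Or.inr (twoPetals ha he hd hea.symm hda hde hsw'' hsw)
      · exact Or.inl ⟨_, hdnew, _, nJ he hb heold, union_ne_union_of_not_swallowed hK hd he hde hxd hxK hxb⟩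
    · push Not at hold
      by_cases hdiff : ∃ a ∈ above P r, ∃ a' ∈ above P r, a ∪ b ≠ a' ∪ b
      · obtain ⟨a, ha, a', ha', hne⟩ := hdiff
        exact Or.inl ⟨_, nJ ha hb (hold a ha), _, nJ ha' hb (hold a' ha'), hne⟩
      · -- all cross joins over b coincide: every petal is inside b
        push Not at hdiff
        have hsw : ∀ {a : Finset α}, a ∈ above P r → ∀ x ∈ a, x ∉ K → x ∈ b := by
          intro a ha x hxa hxK
          obtain ⟨a', ha', hne⟩ := exists_mem_ne h1 a
          by_contra hxb
          exact union_ne_union_of_not_swallowed hK ha ha' hne.symm hxa hxK hxb (hdiff a ha a' ha')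
        exact Or.inr (twoPetals ha₁ ha₂ ha₃ h12 h13.symm h23.symm (hsw ha₁) (hsw ha₂))
  -- (III) at least one new join over b₁
  have oneJoin : ∃ W, W ∈ newJoins P r := by
    by_cases hold : ∃ a ∈ above P r, a ∪ b₁ ∈ joins (above P r)
    · obtain ⟨a, ha, hab⟩ := hold
      obtain ⟨e, he, hea, hsw, hbae⟩ := exists_swallowed_of_union_mem_joins hanti h1 hK ha hab
      obtain ⟨d, hd, hda, hde⟩ := exists_third (by omega : 3 ≤ #(above P r)) a e
      exact ⟨_, nJ hd hb₁ (union_not_mem_joins_of_third hanti h1 hK ha he hd hb₁ hea.symm hda hde hsw hbae)⟩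
    · push Not at hold
      exact ⟨_, nJ ha₁ hb₁ (hold a₁ ha₁)⟩
  -- (IV) assemble
  by_cases hx : ∃ Z, Z ∈ newMeets P r
  · obtain ⟨Z, hZ⟩ := hx
    obtain ⟨W, hW⟩ := oneJoin
    rcases perB hb₁ with ⟨W₁, hW₁, W₂, hW₂, hW12⟩ | ⟨Z₁, hZ₁, Z₂, hZ₂, hZ12⟩
    · exact cnt12 hZ hW₁ hW₂ hW12
    · exact cnt21 hZ₁ hZ₂ hZ12 hW
  · -- no new meet at all: every cross meet is old; member b₁ is "all old"
    push Not at hx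
    have old : ∀ {a : Finset α}, a ∈ above P r → a ∩ b₁ = b₁ ∩ b₂ := by
      intro a ha; by_contra hne; exact hx _ (nM ha hb₁ hne)
    exact allOld hb₁ (old ha₁) (old ha₂) (old ha₃)

/-- **`2 + 3`, co-sunflower below**, by complement duality. [this work] -/
theorem three_le_newLabels_of_two_cosunflower_three {P : Finset (Finset α)} {r : α} {U : Finset α}
    (hanti : IsAntichain (· ⊆ ·) (P : Set (Finset α))) (h2 : #(above P r) = 2) (h3 : #(below P r) = 3)
    (hU : ∀ b ∈ below P r, ∀ b' ∈ below P r, b ≠ b' → b ∪ b' = U) : 3 ≤ newLabels P r := by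
  set F := insert r (P.sup id) with hF
  have hP : ∀ a ∈ P, a ⊆ F := subset_insert_sup P r
  have hr : r ∈ F := mem_insert_self _ _
  rw [← newLabels_image_compl hP hr]
  refine three_le_newLabels_of_sunflower_three_two (K := F \ U) (isAntichain_image_compl hanti hP) ?_ ?_ ?_
  · rw [card_above_image_compl hP hr, h3]
  · rw [card_below_image_compl hP hr, h2]
  · intro x hx y hy hxy
    rw [above_image_compl (P := P) hr] at hx hy
    obtain ⟨b, hb, rfl⟩ := mem_image.1 hx
    obtain ⟨b', hb', rfl⟩ := mem_image.1 hy
    have hbb' : b ≠ b' := by rintro rfl; exact hxy rfl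
    rw [← sdiff_union_distrib, hU b hb b' hb' hbb']

end Summit.CriticalPhenomena.PercolationContinuityZ3.Theorems.SahiColouredDaykin
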